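import Mathlib
import Summits.ValiantsHypothesis.ValiantsHypothesis.Theorems.GeneratorObstructionsPowGenDegreeQPPermFibers

/-!
# Route GeneratorObstructions — crux K2 `PowGenDegreeQP` (stmt-ValiantsHypothesis-11655), line
# `trace-side-regimes`: class-preserving TUPLES of permutations (product form of `…PermFibers`)

For a family of class maps `f n : α n → K n` (one per column `n` of a tableau), the tuples
`π : Π n, Perm (α n)` all of whose components preserve their classes are exactly the tuples assembled
fibrewise, `fiberPermPi f ρ`, `ρ : Π n, Π k, Perm {a // f n a = k}`, injectively; hence
`Σ_{π, all class-preserving} F π = Σ_ρ F (fiberPermPi f ρ)` (`sum_ite_classPreservingPi`), with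
`∏_n sign (π n) = ∏_n ∏_k sign (ρ n k)` (`prod_sign_fiberPermPi`).  This is the form in which the
factorisation half of the last certificate theorem `gadgetTab_count` consumes type preservation
(`…GadgetTableauTypes`): the sum over `(gadgetTab …).Bij` restricted to block-respecting tuples becomes
a sum over per-(column, block) permutations.

Honest framing: elementary; no stub, crux or summit is settled here; `VP ≠ VNP` untouched. [folklore]
-/

namespace Summit.ValiantsHypothesis.ValiantsHypothesis.Theorems.GeneratorObstructions.PowGenDegreeQP

-- `Summit.ValiantsHypothesis.ValiantsHypothesis.…` is the tree's mandated single-conjunct layout.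
set_option linter.dupNamespace false

section PermFibersPi

variable {ι : Type*} {α : ι → Type*} {K : ι → Type*} (f : (n : ι) → α n → K n)

/-- Tuples of permutations assembled fibrewise, column by column. [folklore] -/
def fiberPermPi (ρ : (n : ι) → (k : K n) → Equiv.Perm {a : α n // f n a = k}) :
    (n : ι) → Equiv.Perm (α n) :=
  fun n => fiberPerm (f n) (ρ n)

/-- Components of an assembled tuple preserve classes. [folklore] -/
theorem apply_fiberPermPi (ρ : (n : ι) → (k : K n) → Equiv.Perm {a : α n // f n a = k}) (n : ι)
    (a : α n) : f n (fiberPermPi f ρ n a) = f n a :=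
  apply_fiberPerm (f n) (ρ n) a

/-- `fiberPermPi f` is injective. [folklore] -/
theorem fiberPermPi_injective : Function.Injective (fiberPermPi f) := by
  intro ρ ρ' h
  funext n
  exact fiberPerm_injective (f n) (congrFun h n)

/-- The class-preserving tuples are exactly the assembled ones. [folklore] -/
theorem filter_classPreservingPi_eq_image [Fintype ι] [DecidableEq ι] [∀ n, Fintype (α n)]
    [∀ n, DecidableEq (α n)] [∀ n, Fintype (K n)] [∀ n, DecidableEq (K n)] :
    (Finset.univ.filter fun π : (n : ι) → Equiv.Perm (α n) => ∀ n a, f n (π n a) = f n a) =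
      Finset.univ.image (fiberPermPi f) := by
  ext π
  simp only [Finset.mem_filter, Finset.mem_univ, true_and, Finset.mem_image]
  constructor
  · intro hπ
    refine ⟨fun n => restrictFibers (f n) (π n) (hπ n), ?_⟩
    funext n
    exact fiberPerm_restrictFibers (f n) (π n) (hπ n)
  · rintro ⟨ρ, rfl⟩
    exact apply_fiberPermPi f ρ

/-- **Summing over class-preserving tuples = summing over tuples of fibre permutations.** [folklore] -/
theorem sum_ite_classPreservingPi [Fintype ι] [DecidableEq ι] [∀ n, Fintype (α n)]
    [∀ n, DecidableEq (α n)] [∀ n, Fintype (K n)] [∀ n, DecidableEq (K n)]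
    {M : Type*} [AddCommMonoid M] (F : ((n : ι) → Equiv.Perm (α n)) → M) :
    (∑ π : (n : ι) → Equiv.Perm (α n), if (∀ n a, f n (π n a) = f n a) then F π else 0) =
      ∑ ρ : (n : ι) → (k : K n) → Equiv.Perm {a : α n // f n a = k}, F (fiberPermPi f ρ) := by
  rw [← Finset.sum_filter, filter_classPreservingPi_eq_image,
    Finset.sum_image (fun ρ _ ρ' _ h => fiberPermPi_injective f h)]

/-- The sign product of an assembled tuple. [folklore] -/
theorem prod_sign_fiberPermPi [Fintype ι] [∀ n, Fintype (α n)] [∀ n, DecidableEq (α n)]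
    [∀ n, Fintype (K n)] [∀ n, DecidableEq (K n)]
    (ρ : (n : ι) → (k : K n) → Equiv.Perm {a : α n // f n a = k}) :
    ∏ n, Equiv.Perm.sign (fiberPermPi f ρ n) = ∏ n, ∏ k, Equiv.Perm.sign (ρ n k) :=
  Finset.prod_congr rfl fun n _ => sign_fiberPerm (f n) (ρ n)

/-- **Signed form.** [folklore] -/
theorem sum_sign_ite_classPreservingPi [Fintype ι] [DecidableEq ι] [∀ n, Fintype (α n)]
    [∀ n, DecidableEq (α n)] [∀ n, Fintype (K n)] [∀ n, DecidableEq (K n)]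
    {R : Type*} [CommRing R] (G : ((n : ι) → Equiv.Perm (α n)) → R) :
    (∑ π : (n : ι) → Equiv.Perm (α n),
      if (∀ n a, f n (π n a) = f n a) then (∏ n, ((Equiv.Perm.sign (π n) : ℤ) : R)) * G π else 0) =
      ∑ ρ : (n : ι) → (k : K n) → Equiv.Perm {a : α n // f n a = k},
        (∏ n, ∏ k, ((Equiv.Perm.sign (ρ n k) : ℤ) : R)) * G (fiberPermPi f ρ) := by
  rw [sum_ite_classPreservingPi f (fun π => (∏ n, ((Equiv.Perm.sign (π n) : ℤ) : R)) * G π)]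
  refine Finset.sum_congr rfl fun ρ _ => ?_
  congr 1
  refine Finset.prod_congr rfl fun n _ => ?_
  change ((Equiv.Perm.sign (fiberPerm (f n) (ρ n)) : ℤ) : R) = _
  rw [sign_fiberPerm, Units.coe_prod, Int.cast_prod]

end PermFibersPi

end Summit.ValiantsHypothesis.ValiantsHypothesis.Theorems.GeneratorObstructions.PowGenDegreeQP
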